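import Summits.QuantumFields.GaugeBoot.NonBacktrackingHolonomy
import HarnessLib

/-!
# Walks as words of `ℤ^d`: the exact domain of the walk hypotheses of the large-`N` theorems (gauge-boot, large-`N` supplement 16, part 3)

HONEST FRAMING (cell `pub-gaugeboot`, page 1 of every file): the venture produces certified bounds
on lattice expectations at stated coupling, gauge group, dimension and torus size; NOT a mass gap,
NOT a continuum limit, NOT a string tension; NOT large `N` unless marked CONDITIONAL; NOT
Yang–Mills-summit-bearing (barriers `FixedCouplingUltralocality`, `PerturbativeInvisibility`).
Lattice combinatorics; this file certifies no number.

## Content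

The converse bridge to `ZdWordWalks.lean` (word → walk): walk → word.

* `dartToStep`, `walkWordZd γ` — the word (one `Step` per dart) of a lattice walk; `endpointZd_walkWordZd`,
  `length_walkWordZd`, ★ `wordHolonomyZd_walkWordZd` (SAME HOLONOMY on every configuration, any group),
  `walkWordZd_toWalkZd` / `walkWordZd_toLoopZd` (round trip), `walkWordZd_injective`;
* ★★ `cyclicallyReduced_walkWordZd_iff` — **the word of a closed walk is cyclically reduced iff the walk is
  non-backtracking** (Shen–Zhu–Zhu's `IsNonBacktrackingLoop`); with `ZdWordWalks` this closes item (lxiv):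
  `IsNonBacktrackingLoop ↔ CyclicallyReduced` in both directions, on both sides of the dictionary;
* ★★★ `exists_isNonBacktrackingLoop_realising_iff` — **THE EXACT DOMAIN OF THE WALK HYPOTHESES**: for
  `N ≥ 2` and a reduced word `w` at `x`, there is a non-backtracking closed walk `γ` with
  `walkHolonomy U γ = wordHolonomyZd U x w` for every `SU(N)` configuration `U` IF AND ONLY IF `w` is
  closed at `x` and cyclically reduced; and then `γ` is unique, `γ = Word.toLoopZd x w`
  (`eq_toLoopZd_of_realising`).  So the walk data `(γ, hγ, hhol)` taken by
  `loopImCov_le_of_szz`, `PlanarCertificate.eventually_obj_le_suN_strongCoupling`,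
  `abs_loopQ_conjPath_sub_loopQ_le_of_szz`, … exist for EXACTLY the closed cyclically reduced words —
  the degenerate plaquette words `plaqWord a a ε` of supplement 9's erratum being the excluded case
  (`NonBacktrackingHolonomy.not_exists_isNonBacktrackingLoop_realising_plaqWord_self`).

The `⇒` direction uses the free configuration of part 2 (reduced words with the same holonomy function
over `SU(N)`, `N ≥ 2`, are equal); for `N = 1` it fails (every word is realised by every loop).  [folklore].
-/

noncomputable section

open SimpleGraph
open Literature.Probability.LatticeModels (Site zdGraph)
open Literature.MathematicalPhysics.QuantumLattice
open Literature.MathematicalPhysics.QuantumFieldTheory (IsNonBacktrackingLoop)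

namespace Summit.QuantumFields.GaugeBoot

variable {d : ℕ}

/-! ## The step of a dart -/

/-- The step (`±e_axis`) of a dart of `ℤ^d`. [folklore] -/
def dartToStep (e : (zdGraph d).Dart) : Step d :=
  if (dartStep e).2 then .fwd (dartStep e).1.2 else .bwd (dartStep e).1.2

/-- The `FreeGroup ℕ` code of the step of a dart is the dart's code. [folklore] -/
theorem stepCode_dartToStep (e : (zdGraph d).Dart) : stepCode (dartToStep e) = dartCode e := by
  unfold dartToStep dartCode
  cases (dartStep e).2 <;> rfl

/-- The edge of a positively oriented dart `x → x + e_i` is `(x, i)`. [folklore] -/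
theorem dartStep_fst_of_snd_eq_true {e : (zdGraph d).Dart} (h : (dartStep e).2 = true) :
    (dartStep e).1 = (e.fst, dartDir e) := by
  rw [dartStep, if_pos (snd_eq_of_dartStep_snd_eq_true h)]

/-- The edge of a negatively oriented dart `y + e_i → y` is `(y, i)`. [folklore] -/
theorem dartStep_fst_of_snd_eq_false {e : (zdGraph d).Dart} (h : (dartStep e).2 = false) :
    (dartStep e).1 = (e.snd, dartDir e) := by
  have h' : ¬ e.snd = e.fst + Pi.single (dartDir e) 1 := fun h'' => by
    rw [dartStep, if_pos h''] at h; exact Bool.noConfusion h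
  rw [dartStep, if_neg h']

/-- A positively oriented dart steps `+e_axis`. [folklore] -/
theorem dartToStep_of_snd_eq_true {e : (zdGraph d).Dart} (h : (dartStep e).2 = true) : dartToStep e = .fwd (dartDir e) := by
  rw [dartToStep, if_pos h, dartStep_fst_of_snd_eq_true h]

/-- A negatively oriented dart steps `−e_axis`. [folklore] -/
theorem dartToStep_of_snd_eq_false {e : (zdGraph d).Dart} (h : (dartStep e).2 = false) : dartToStep e = .bwd (dartDir e) := by
  simp [dartToStep, h, dartStep_fst_of_snd_eq_false h]

/-- **The step of a dart leads from its tail to its head.** [folklore] -/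
theorem applyZd_dartToStep (e : (zdGraph d).Dart) : (dartToStep e).applyZd e.fst = e.snd := by
  cases h : (dartStep e).2
  · rw [dartToStep_of_snd_eq_false h, Step.applyZd_bwd, fst_eq_of_dartStep_snd_eq_false h, add_sub_cancel_right]
  · rw [dartToStep_of_snd_eq_true h, Step.applyZd_fwd, snd_eq_of_dartStep_snd_eq_true h]

/-- **The step of a dart carries the dart's holonomy** (any group). [folklore] -/
theorem stepHolonomyZd_dartToStep {G : Type*} [Group G] (U : LGConfig d G) (e : (zdGraph d).Dart) :
    stepHolonomyZd U e.fst (dartToStep e) = dartHolonomy U e := by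
  cases h : (dartStep e).2
  · rw [dartToStep_of_snd_eq_false h, stepHolonomyZd_bwd]
    simp only [dartHolonomy, h, Bool.false_eq_true, ↓reduceIte, dartStep_fst_of_snd_eq_false h]
    rw [fst_eq_of_dartStep_snd_eq_false h, add_sub_cancel_right]
  · rw [dartToStep_of_snd_eq_true h, stepHolonomyZd_fwd]
    simp only [dartHolonomy, h, ↓reduceIte, dartStep_fst_of_snd_eq_true h]

/-- A step from `x` is determined by where it leads. [folklore] -/
theorem Step.eq_of_applyZd_eq (x : Site d) {s t : Step d} (h : t.applyZd x = s.applyZd x) : t = s := by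
  have h1 : t.inv.applyZd (s.applyZd x) = x := by rw [← h, Step.applyZd_inv_applyZd]
  have h2 := (Step.applyZd_applyZd_eq_iff x s t.inv).1 h1
  rw [← Step.inv_inv t, h2, Step.inv_inv]

/-- The step of the dart of a step is that step. [folklore] -/
theorem dartToStep_stepDart (x : Site d) (s : Step d) : dartToStep (stepDart x s) = s :=
  Step.eq_of_applyZd_eq x (applyZd_dartToStep (stepDart x s))

/-- Reversing a dart inverts its step. [folklore] -/
theorem dartToStep_symm (e : (zdGraph d).Dart) : dartToStep e.symm = (dartToStep e).inv := by
  unfold dartToStep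
  rw [dartStep_symm]
  cases (dartStep e).2 <;> rfl

/-- **Adjacent darts backtrack iff their steps are inverse.** [folklore] -/
theorem dartToStep_eq_inv_iff {a b : (zdGraph d).Dart} (hadj : (zdGraph d).DartAdj a b) :
    dartToStep b = (dartToStep a).inv ↔ b = a.symm := by
  refine ⟨fun h => ?_, fun h => by rw [h, dartToStep_symm]⟩
  by_contra hne
  have hrel := dartCode_rel_of_dartAdj hadj hne
  rw [← stepCode_dartToStep, ← stepCode_dartToStep, h] at hrel
  revert hrel
  cases dartToStep a <;> simp [stepCode, Step.inv]

/-- Transfer of the non-backtracking condition along a chain of adjacent darts. [folklore] -/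
theorem isChain_map_dartToStep_iff : ∀ {l : List (zdGraph d).Dart}, l.IsChain (zdGraph d).DartAdj →
    ((l.map dartToStep).IsChain (fun s t => t ≠ s.inv) ↔ l.IsChain (fun a b => b ≠ a.symm))
  | [], _ => by simp
  | [a], _ => by simp
  | a :: b :: l, h => by
    rw [List.isChain_cons_cons] at h
    rw [List.map_cons, List.map_cons, List.isChain_cons_cons, List.isChain_cons_cons, ← List.map_cons,
      isChain_map_dartToStep_iff h.2]
    exact (not_congr (dartToStep_eq_inv_iff h.1)).and Iff.rfl

/-! ## The word of a walk -/

/-- **The word of a walk**: one step per dart. [folklore] -/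
def walkWordZd {x y : Site d} (γ : (zdGraph d).Walk x y) : Word d := γ.darts.map dartToStep

/-- Unfolding on `cons`. [folklore] -/
theorem walkWordZd_cons {x y z : Site d} (h : (zdGraph d).Adj x y) (p : (zdGraph d).Walk y z) :
    walkWordZd (Walk.cons h p) = dartToStep ⟨(x, y), h⟩ :: walkWordZd p := by
  simp [walkWordZd, Walk.darts_cons]

/-- Unfolding on `nil`. [folklore] -/
@[simp] theorem walkWordZd_nil (x : Site d) : walkWordZd (Walk.nil : (zdGraph d).Walk x x) = [] := rfl

/-- The word of a walk has the walk's length. [folklore] -/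
@[simp] theorem length_walkWordZd {x y : Site d} (γ : (zdGraph d).Walk x y) : (walkWordZd γ).length = γ.length := by
  simp [walkWordZd, Walk.length_darts]

/-- The word of a walk ends where the walk ends. [folklore] -/
theorem endpointZd_walkWordZd {x : Site d} : ∀ {y : Site d} (γ : (zdGraph d).Walk x y), Word.endpointZd x (walkWordZd γ) = y
  | _, .nil => rfl
  | _, .cons h p => by
    rw [walkWordZd_cons, Word.endpointZd_cons, applyZd_dartToStep ⟨(x, _), h⟩]
    exact endpointZd_walkWordZd p

/-- ★ **The word of a walk has the walk's holonomy on every configuration** (any group). [folklore] -/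
theorem wordHolonomyZd_walkWordZd {G : Type*} [Group G] (U : LGConfig d G) {x : Site d} :
    ∀ {y : Site d} (γ : (zdGraph d).Walk x y), wordHolonomyZd U x (walkWordZd γ) = walkHolonomy U γ
  | _, .nil => by simp
  | _, .cons h p => by
    rw [walkWordZd_cons, wordHolonomyZd_cons, walkHolonomy_cons, applyZd_dartToStep ⟨(x, _), h⟩,
      stepHolonomyZd_dartToStep U ⟨(x, _), h⟩, wordHolonomyZd_walkWordZd U p]

/-- Round trip: the word of the walk of a word is the word. [folklore] -/
theorem walkWordZd_toWalkZd : ∀ (x : Site d) (w : Word d), walkWordZd (Word.toWalkZd x w) = w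
  | _, [] => rfl
  | x, s :: w => by
    show walkWordZd (Walk.cons (Step.adj_applyZd x s) (Word.toWalkZd (s.applyZd x) w)) = s :: w
    rw [walkWordZd_cons, walkWordZd_toWalkZd (s.applyZd x) w]
    exact congrArg (· :: w) (dartToStep_stepDart x s)

/-- Round trip for closed words. [folklore] -/
theorem walkWordZd_toLoopZd (x : Site d) (w : Word d) (hw : Word.endpointZd x w = x) : walkWordZd (Word.toLoopZd x w hw) = w := by
  rw [Word.toLoopZd, walkWordZd, Walk.darts_copy, ← walkWordZd, walkWordZd_toWalkZd]

/-- **A walk is determined by its start and its word.** [folklore] -/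
theorem walkWordZd_injective {x : Site d} : ∀ {y : Site d} (p q : (zdGraph d).Walk x y), walkWordZd p = walkWordZd q → p = q
  | _, .nil, .nil, _ => rfl
  | _, .nil, .cons h q, e => by
    have := congrArg List.length e; simp [walkWordZd, Walk.darts_cons] at this
  | _, .cons h p, .nil, e => by
    have := congrArg List.length e; simp [walkWordZd, Walk.darts_cons] at this
  | _, .cons (v := y₁) h p, .cons (v := y₂) h' q, e => by
    rw [walkWordZd_cons, walkWordZd_cons, List.cons.injEq] at e
    obtain rfl : y₁ = y₂ := by
      have h1 : (dartToStep ⟨(x, y₁), h⟩).applyZd x = y₁ := applyZd_dartToStep ⟨(x, y₁), h⟩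
      have h2 : (dartToStep ⟨(x, y₂), h'⟩).applyZd x = y₂ := applyZd_dartToStep ⟨(x, y₂), h'⟩
      rw [e.1] at h1
      exact h1.symm.trans h2
    rw [walkWordZd_injective p q e.2]

/-! ## Closed walks: cyclically reduced words ↔ non-backtracking loops -/

/-- The first dart of a walk starts at the walk's start. [folklore] -/
theorem fst_head_darts {V : Type*} {G : SimpleGraph V} {u v : V} : ∀ (p : G.Walk u v) (h : p.darts ≠ []), (p.darts.head h).fst = u
  | .nil, h => absurd rfl h
  | .cons _ _, _ => rfl

/-- The last dart of a walk ends at the walk's end. [folklore] -/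
theorem snd_getLast_darts {V : Type*} {G : SimpleGraph V} {u : V} : ∀ {v : V} (p : G.Walk u v) (h : p.darts ≠ []), (p.darts.getLast h).snd = v
  | _, .nil, h => absurd rfl h
  | _, .cons _ .nil, _ => rfl
  | _, .cons h₁ (.cons h₂ q), hn => by
    have hne : (Walk.cons h₂ q).darts ≠ [] := by simp [Walk.darts_cons]
    have e : (Walk.cons h₁ (Walk.cons h₂ q)).darts.getLast hn = (Walk.cons h₂ q).darts.getLast hne := by
      simp only [Walk.darts_cons, List.getLast_cons_cons]
    rw [e]
    exact snd_getLast_darts (Walk.cons h₂ q) hne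

/-- The darts of a closed walk, followed by the first dart again, form a chain of adjacent darts. [folklore] -/
theorem isChain_dartAdj_darts_cyclic {x : Site d} (γ : (zdGraph d).Walk x x) (h : γ.darts ≠ []) :
    (γ.darts ++ γ.darts.take 1).IsChain (zdGraph d).DartAdj := by
  obtain ⟨a₀, rest, hd⟩ := List.exists_cons_of_ne_nil h
  have htake : γ.darts.take 1 = [a₀] := by rw [hd]; rfl
  rw [htake]
  refine List.IsChain.append γ.isChain_dartAdj_darts (List.isChain_singleton a₀) fun a ha b hb => ?_
  obtain ⟨h', rfl⟩ := List.mem_getLast?_eq_getLast ha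
  simp only [List.head?_cons, Option.mem_some_iff] at hb
  subst hb
  have h0 : γ.darts.head h = a₀ := (List.head_eq_iff_head?_eq_some h).2 (by rw [hd]; rfl)
  show (γ.darts.getLast h').snd = a₀.fst
  rw [snd_getLast_darts γ h', ← h0, fst_head_darts γ h]

/-- ★★ **The word of a closed walk is cyclically reduced iff the walk is non-backtracking** (Shen–Zhu–Zhu's
`IsNonBacktrackingLoop`). [folklore] -/
theorem cyclicallyReduced_walkWordZd_iff {x : Site d} (γ : (zdGraph d).Walk x x) :
    (walkWordZd γ).CyclicallyReduced ↔ IsNonBacktrackingLoop γ := by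
  unfold Word.CyclicallyReduced IsNonBacktrackingLoop
  by_cases h : γ.darts = []
  · have hl : γ.length = 0 := by rw [← Walk.length_darts, h]; rfl
    simp [walkWordZd, h, hl]
  · have hlen : 0 < γ.length := by
      rw [← Walk.length_darts]; exact List.length_pos_iff.2 h
    rw [walkWordZd, ← List.map_take, ← List.map_append, isChain_map_dartToStep_iff (isChain_dartAdj_darts_cyclic γ h)]
    exact ⟨fun h' => ⟨hlen, h'.2⟩, fun h' => ⟨by simpa using h, h'.2⟩⟩

/-- Hence a non-backtracking closed walk IS the loop of its (closed, cyclically reduced) word. [folklore] -/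
theorem toLoopZd_walkWordZd {x : Site d} (γ : (zdGraph d).Walk x x) :
    Word.toLoopZd x (walkWordZd γ) (endpointZd_walkWordZd γ) = γ :=
  walkWordZd_injective _ _ (walkWordZd_toLoopZd x _ _)

/-! ## The exact domain of the walk hypotheses -/

/-- ★★★ **THE EXACT DOMAIN OF THE WALK HYPOTHESES OF THE LARGE-`N` THEOREMS.**  `N ≥ 2`, `w` a reduced word
(no letter followed by its inverse) at `x`.  There is a non-backtracking closed walk `γ` at `x` whose
holonomy agrees with that of `w` on EVERY `SU(N)` configuration **iff `w` is closed at `x` and cyclically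
reduced.** [folklore] -/
theorem exists_isNonBacktrackingLoop_realising_iff {N : ℕ} (hN : 2 ≤ N) (x : Site d) {w : Word d}
    (hred : w.IsChain (fun s t => t ≠ s.inv)) :
    (∃ γ : (zdGraph d).Walk x x, IsNonBacktrackingLoop γ ∧ ∀ U : LGConfig d (SU N), walkHolonomy U γ = wordHolonomyZd U x w) ↔
      Word.endpointZd x w = x ∧ w.CyclicallyReduced := by
  constructor
  · rintro ⟨γ, hγ, hhol⟩
    have hcr : (walkWordZd γ).CyclicallyReduced := (cyclicallyReduced_walkWordZd_iff γ).2 hγ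
    have heq : walkWordZd γ = w :=
      eq_of_forall_wordHolonomyZd_eq hN x hcr.2.left_of_append hred fun U => by rw [wordHolonomyZd_walkWordZd, hhol U]
    subst heq
    exact ⟨endpointZd_walkWordZd γ, hcr⟩
  · rintro ⟨hx, hcr⟩
    exact ⟨Word.toLoopZd x w hx, isNonBacktrackingLoop_toLoopZd x w hx hcr, fun U => walkHolonomy_toLoopZd U x w hx⟩

/-- **… and the realising walk is unique**: it is `Word.toLoopZd x w`. [folklore] -/
theorem eq_toLoopZd_of_realising {N : ℕ} (hN : 2 ≤ N) (x : Site d) {w : Word d} (hred : w.IsChain (fun s t => t ≠ s.inv))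
    (γ : (zdGraph d).Walk x x) (hγ : IsNonBacktrackingLoop γ) (hhol : ∀ U : LGConfig d (SU N), walkHolonomy U γ = wordHolonomyZd U x w) :
    ∃ hx : Word.endpointZd x w = x, γ = Word.toLoopZd x w hx := by
  have hcr : (walkWordZd γ).CyclicallyReduced := (cyclicallyReduced_walkWordZd_iff γ).2 hγ
  have heq : walkWordZd γ = w :=
    eq_of_forall_wordHolonomyZd_eq hN x hcr.2.left_of_append hred fun U => by rw [wordHolonomyZd_walkWordZd, hhol U]
  subst heq
  exact ⟨endpointZd_walkWordZd γ, (toLoopZd_walkWordZd γ).symm⟩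

/-- **Two non-backtracking closed walks with the same holonomy function over `SU(N)`, `N ≥ 2`, are equal.**
[folklore] -/
theorem eq_of_forall_walkHolonomy_eq {N : ℕ} (hN : 2 ≤ N) {x : Site d} (γ γ' : (zdGraph d).Walk x x) (hγ : IsNonBacktrackingLoop γ)
    (hγ' : IsNonBacktrackingLoop γ') (h : ∀ U : LGConfig d (SU N), walkHolonomy U γ = walkHolonomy U γ') : γ = γ' := by
  have hcr := (cyclicallyReduced_walkWordZd_iff γ).2 hγ
  have hcr' := (cyclicallyReduced_walkWordZd_iff γ').2 hγ'
  exact walkWordZd_injective γ γ' (eq_of_forall_wordHolonomyZd_eq hN x hcr.2.left_of_append hcr'.2.left_of_append fun U => by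
    rw [wordHolonomyZd_walkWordZd, wordHolonomyZd_walkWordZd, h U])

end Summit.QuantumFields.GaugeBoot

end
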